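import Summits.Ventures.PercRepro.RankLevelSetTightArith

/-!
# PercRepro — THE UNIFORM DEMAND OF THE AVERAGED IDENTITY (night-1, gen 9 session 4; dossier §19.12 (c))

The independent subsets `T ⊆ A` of a member `A` of `U(p,q)` pay, by the LYM count, at least
`Σ_{u=q+1}^{p−1} w_u · C(p,u)/C(n−u,p−u)` with `w_{q+1} = n` and `w_u = n − u` for `u ≥ q + 2` (`n = p + q`); this file
shows that this sum is EXACTLY the uniform demand `n·Φ(p,q) − p·Φ(p−1,q)` of the averaged identity:

* `mul_ratio_eq_pred` — `u·C(p,u)/C(n−u,p−u) = p·C(p−1,u−1)/C(n−u,p−u)` (`Nat.succ_mul_choose_eq`);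
* `sum_mul_ratio_eq` — `Σ_{q<u<p} u·C(p,u)/C(n−u,p−u) = p·C(p−1,q)/C(n−q−1,p−q−1) + p·Φ(p−1,q)` (reindexing);
* `sum_weight_ratio_eq` — `Σ_{q<u<p} w_u·C(p,u)/C(n−u,p−u) = n·Φ(p,q) − p·Φ(p−1,q)`.

Axioms: standard.
-/

namespace PercRepro

open Finset

/-- The ratio `C(p,u)/C(p+q−u,p−u)` (`= C(n,u)/C(n,p)`, `choose_div_choose_eq`). -/
noncomputable def ratioK (p q u : ℕ) : ℚ :=
  ((p.choose u : ℕ) : ℚ) / (((p + q - u).choose (p - u) : ℕ) : ℚ)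

/-- The weight of a supply set of size `u`: `n` at `u = q + 1`, `n − u` above. -/
noncomputable def weightK (p q u : ℕ) : ℚ :=
  if u = q + 1 then ((p + q : ℕ) : ℚ) else ((p + q - u : ℕ) : ℚ)

/-- `Φ(p,q) = Σ_{q<u<p} ratioK p q u`. -/
lemma phiK_eq_sum_ratioK (p q : ℕ) : phiK p q = ∑ u ∈ Finset.Ioo q p, ratioK p q u :=
  phiK_eq_sum_ratio p q

/-- `u · C(p,u)/C(n−u,p−u) = p · C(p−1,u−1)/C(n−u,p−u)` for `1 ≤ u`. -/
lemma mul_ratio_eq_pred {p q u : ℕ} (hu : 1 ≤ u) :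
    (u : ℚ) * ratioK p q u =
      (p : ℚ) * (((p - 1).choose (u - 1) : ℕ) : ℚ) / (((p + q - u).choose (p - u) : ℕ) : ℚ) := by
  unfold ratioK
  rw [mul_div_assoc']
  congr 1
  rcases Nat.eq_zero_or_pos p with hp | hp
  · subst hp
    rw [Nat.choose_eq_zero_of_lt (by omega : 0 < u)]
    simp
  · have h := Nat.add_one_mul_choose_eq (p - 1) (u - 1)
    rw [show p - 1 + 1 = p by omega, show u - 1 + 1 = u by omega] at h
    -- h : p * (p - 1).choose (u - 1) = p.choose u * u
    have h' : ((p : ℕ) : ℚ) * (((p - 1).choose (u - 1) : ℕ) : ℚ) = ((p.choose u : ℕ) : ℚ) * (u : ℚ) := by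
      exact_mod_cast h
    linarith [h']

/-- `Σ_{q<u<p} u · C(p,u)/C(n−u,p−u) = p·C(p−1,q)/C(n−q−1,p−q−1) + p·Φ(p−1,q)` for `1 ≤ q`, `q + 2 ≤ p`. -/
lemma sum_mul_ratio_eq {p q : ℕ} (hq : 1 ≤ q) (hpq : q + 2 ≤ p) :
    ∑ u ∈ Finset.Ioo q p, (u : ℚ) * ratioK p q u =
      (p : ℚ) * (((p - 1).choose q : ℕ) : ℚ) / (((p + q - (q + 1)).choose (p - (q + 1)) : ℕ) : ℚ) +
        (p : ℚ) * phiK (p - 1) q := by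
  -- the summand is `g (u − 1)` with `g v = p·C(p−1,v)/C(n−1−v,p−1−v)`
  set g : ℕ → ℚ := fun v =>
    (p : ℚ) * (((p - 1).choose v : ℕ) : ℚ) / (((p - 1 + q - v).choose (p - 1 - v) : ℕ) : ℚ) with hg
  have hsum : ∑ u ∈ Finset.Ioo q p, (u : ℚ) * ratioK p q u = ∑ u ∈ Finset.Ioo q p, g (u - 1) := by
    refine Finset.sum_congr rfl (fun u hu => ?_)
    rw [Finset.mem_Ioo] at hu
    rw [mul_ratio_eq_pred (by omega), hg]
    simp only
    have h1 : p - 1 + q - (u - 1) = p + q - u := by omega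
    have h2 : p - 1 - (u - 1) = p - u := by omega
    rw [h1, h2]
  rw [hsum, sum_Ioo_pred_eq' g hq hpq]
  congr 1
  · rw [hg]
    simp only
    have h1 : p - 1 + q - q = p + q - (q + 1) := by omega
    have h2 : p - 1 - q = p - (q + 1) := by omega
    rw [h1, h2]
  · rw [phiK_eq_sum_ratio (p - 1) q, Finset.mul_sum]
    refine Finset.sum_congr rfl (fun v _ => ?_)
    rw [hg]
    simp only
    ring

/-- **THE UNIFORM DEMAND**: `Σ_{q<u<p} w_u · C(p,u)/C(n−u,p−u) = n·Φ(p,q) − p·Φ(p−1,q)` for `1 ≤ q`, `q + 2 ≤ p`. -/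
theorem sum_weight_ratio_eq {p q : ℕ} (hq : 1 ≤ q) (hpq : q + 2 ≤ p) :
    ∑ u ∈ Finset.Ioo q p, weightK p q u * ratioK p q u =
      ((p + q : ℕ) : ℚ) * phiK p q - (p : ℚ) * phiK (p - 1) q := by
  -- split the weight: `w_u = (n − u) + [u = q+1]·u`
  have hw : ∀ u ∈ Finset.Ioo q p, weightK p q u * ratioK p q u =
      (((p + q : ℕ) : ℚ) - (u : ℚ)) * ratioK p q u +
        (if u = q + 1 then (u : ℚ) * ratioK p q u else 0) := by
    intro u hu
    rw [Finset.mem_Ioo] at hu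
    unfold weightK
    by_cases h : u = q + 1
    · subst h
      simp only [if_true]
      ring
    · simp only [h, if_false]
      have : ((p + q - u : ℕ) : ℚ) = ((p + q : ℕ) : ℚ) - (u : ℚ) := by
        rw [Nat.cast_sub (by omega)]
      rw [this]
      ring
  rw [Finset.sum_congr rfl hw, Finset.sum_add_distrib, Finset.sum_ite_eq' (Finset.Ioo q p) (q + 1)]
  have hmem : q + 1 ∈ Finset.Ioo q p := by
    rw [Finset.mem_Ioo]; omega
  simp only [hmem, if_true]
  have hsplit : ∑ u ∈ Finset.Ioo q p, (((p + q : ℕ) : ℚ) - (u : ℚ)) * ratioK p q u =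
      ((p + q : ℕ) : ℚ) * phiK p q - ∑ u ∈ Finset.Ioo q p, (u : ℚ) * ratioK p q u := by
    rw [phiK_eq_sum_ratioK, Finset.mul_sum, ← Finset.sum_sub_distrib]
    refine Finset.sum_congr rfl (fun u _ => ?_)
    ring
  rw [hsplit, sum_mul_ratio_eq hq hpq]
  -- the boundary term `(q+1)·ratioK p q (q+1)` equals `p·C(p−1,q)/C(n−q−1,p−q−1)`
  have hb : ((q + 1 : ℕ) : ℚ) * ratioK p q (q + 1) =
      (p : ℚ) * (((p - 1).choose q : ℕ) : ℚ) / (((p + q - (q + 1)).choose (p - (q + 1)) : ℕ) : ℚ) := by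
    rw [mul_ratio_eq_pred (by omega)]
    simp only [Nat.add_sub_cancel]
  rw [hb]
  ring

end PercRepro
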